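import Summits.QuantumFields.YangMills.Theorems.LangevinControlUVFemtoCurvatureSkewnessCRatioTransportDefsC

/-!
# Route `LangevinControlUV`, crux `FemtoCurvatureSkewnessC` (stmt-QuantumFields-16205), line `ratio-transport`: vocabulary (D) —
# the cutoff engine in its weakest typed form (two-ended, arbitrary block factor)

Lead `prover-line-stmt-QuantumFields-16205-c1-0` (line lead, cycle 2, 2026-08-16), companion (D) of the route-posited vocabulary files
`…CRatioTransportDefs.lean` (p121740), `…DefsB.lean` (p123565), `…DefsC.lean` (p125065).  Route-posited `def … : Prop`s only; NOTHING is
asserted; none is a literature fact; none restates the crux.  A separate file (rather than an append to (C)) so that landing it does not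
rebuild the (C) chain under the registered skeleton.
-/

set_option autoImplicit false

noncomputable section

namespace Summit.QuantumFields.YangMills.Cruxes.FemtoCurvatureSkewnessC.RatioTransport

open MeasureTheory Filter Topology
open Literature.MathematicalPhysics.QuantumFieldTheory
open Summit.QuantumFields.YangMills.Theorems.FemtoCurvatureSkewness.Negative (TwoPointPackage)

/-! ## The cutoff engine in its weakest form: TWO-ENDED, arbitrary block factor `M ≥ 2`

Why a second weakening of E_c.  (i) A per-step SUMMABLE bound `Σ_k ε(2^k n₀) → 0` is more than the descent needs: it only ever
compares the two ENDS of a chain — the fine point `(M^k L₀, β, M^k n₀)` and the coarse point `(L₀, β', n₀)` on the same level of the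
chain map (`a β' = M^k · a β`) — so a two-ended `δ`-closeness with `δ`-dependent thresholds `N₀(δ), ℓ_c(δ), β_c(δ)` suffices, and it is
what an engine built on CONTINUITY of renormalised expectations along a convergent RG orbit delivers (Cauchy property, no modulus; e.g. the
realisation functional of `Literature.MathematicalPhysics.QuantumFieldTheory.BalabanBanachStep`, field `continuousOn_expect`), whereas
per-step summability needs a Lipschitz modulus.  (ii) Block factor: v3/v4 hard-wire halving (`L ↦ 2L`), but Bałaban-type block averaging
carries Wilson content only for ODD block factors (`BalabanBanachStep`: tori `2L+1`, blocks centred at sites; Dimock 2013 §2.1 "L odd"), so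
the engine must be free to choose its `M`.  The M-adic two-ended descent is proved in `…CMadicDescent.lean` (this lead); per-step dyadic ⇒ two-ended
with `M = 2` (`cutoffTwoEnded_of_cutoffTransport`) and `CutoffEngine → CutoffEngineTE` in `…CTwoEndedAssembly.lean`, with the assembly
`femtoCurvatureSkewnessC_of_enginesTE : CutoffEngineTE → VolumeEngine → SeparationEngine → Anchors → FemtoCurvatureSkewnessC`. -/

section TwoEnded

variable {G : Type} [Group G] [TopologicalSpace G] [IsTopologicalGroup G] [CompactSpace G]
  [MeasurableSpace G] [BorelSpace G]

/-- **(T_c, two-ended, block factor `M`) Cutoff transport between the two ends of an `M`-adic chain of the unit map `a`** (sign-free):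
for every `δ > 0` there are thresholds `β_c, ℓ_c > 0, N₀ ≥ 1` such that for the fine point `(L, β, M^k n₀)`, `L = M^k L₀`, in the femto
box `L · a β ≤ ℓ_c`, and the coarse point `(L₀, β', n₀)` on the same level, `a β' = M^k · a β`, with `β_c ≤ β' ≤ β`, `n₀ ≥ N₀`,
`8n₀ ≤ L₀`, the tree-normalised skewness ratios differ by at most `δ` (same physical triangle and box, cutoffs `a β` and `M^k a β`). -/
def CutoffTwoEnded (r : LatticeRep G) (a : ℝ → ℝ) (M : ℕ) : Prop :=
  ∀ δ : ℝ, 0 < δ → ∃ (β_c ℓ_c : ℝ) (N₀ : ℕ), 0 < ℓ_c ∧ 1 ≤ N₀ ∧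
    ∀ (L L₀ : ℕ) [NeZero L] [NeZero L₀] (k n₀ : ℕ) (β β' : ℝ), L = M ^ k * L₀ → N₀ ≤ n₀ → 8 * n₀ ≤ L₀ →
      β_c ≤ β' → β' ≤ β → (L : ℝ) * a β ≤ ℓ_c → a β' = (M : ℝ) ^ k * a β →
        |skewRatioT r L β (M ^ k * n₀) - skewRatioT r L₀ β' n₀| ≤ δ

end TwoEnded

/-- **Stub E_c (two-ended form) `CutoffEngineTE` — the RG engine proper in its weakest typed form:** for compact simple `G`, any `r` and
any continuous package map `a₀`, there are a block factor `M ≥ 2` and a continuous positive map `a` dominated by `a₀` whose `M`-adic chains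
carry the two-ended cutoff transport `CutoffTwoEnded r a M`.  Implied by `CutoffEngine` (per-step dyadic, `M = 2`). -/
def CutoffEngineTE : Prop :=
  ∀ (G : Type) [Group G] [TopologicalSpace G] [IsTopologicalGroup G] [CompactSpace G]
    [MeasurableSpace G] [BorelSpace G], IsCompactSimpleLieGroup G →
    ∀ (r : LatticeRep G) (a₀ : ℝ → ℝ), Continuous a₀ → TwoPointPackage r a₀ →
      ∃ M : ℕ, 2 ≤ M ∧ ∃ a : ℝ → ℝ, Continuous a ∧ (∀ β, 0 < a β) ∧ Dominated a a₀ ∧ CutoffTwoEnded r a M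

/-- Registered signature of stub E_c in two-ended form (skeleton v4.1). -/
def Sig.stub_cutoffEngineTE : Prop := CutoffEngineTE

end Summit.QuantumFields.YangMills.Cruxes.FemtoCurvatureSkewnessC.RatioTransport

end
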